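import Summits.HubbardSuperconductivity.HubbardSuperconductivity.Theorems.AposterioriCapRgSsbToEvenTorusLroLadderFixedL
import Summits.HubbardSuperconductivity.HubbardSuperconductivity.Theorems.AposterioriCapRgSsbToEvenTorusLroLadderInductionChains
import Summits.HubbardSuperconductivity.HubbardSuperconductivity.Theorems.AposterioriCapRgSsbToEvenTorusLroLowManifoldTransfer
import Mathlib.Analysis.SpecialFunctions.Pow.Asymptotics
import HarnessLib

/-!
# Route `AposterioriCapRg` — crux `SsbToEvenTorusLro` (stmt-HubbardSuperconductivity-1315),
# line `floating-mu-two-sided-pair-transfer`, stub `stub_ladderInduction`: constants and `∀ᶠ` (INDUCTION 3/3)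

File 3/3 of the INDUCTION stub (1/3 `…LadderInductionStep`: the one-rung steps; 2/3 `…LadderFixedL`: the
ladder at fixed `L` over the abstract CHAINS `…LadderInductionChains`). Here the registered signature
`stub_ladderInduction` (TRANSFER ⇒ the planner's LADDER: RUNG ∧ SEED ∧ RIGIDITY ∧ CONVEXITY ⇒ a uniform pair
floor `aL⁴` on every normalised `(N_L, S^z = 0)`-sector ground state, eventually along `L = 2k+2`) is proved:

* `lil_budget_arith` — the budget: seed floor `bL⁴ − 4cL³ − K(E₁'/A)L⁴` minus `J' ≤ L^{1−ε}/2` rung losses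
  `ℓ ≤ DL³` stays `≥ bL⁴/2` once `8KE₁' ≤ bA`, `16c ≤ bL` and `D·L^{1−ε} ≤ (b/4)L`;
* `lil_window_arith` — the window of sectors within `L` of `N_L` lies inside the RUNG range
  `[(1−δ)L²/4 + 2, (2 − (1−δ)/4)L² − 2]` once `L ≥ 10/(1−δ)`, `L ≥ 4`;
* `stub_ladderInductionOfChains` — CHAINS ⇒ INDUCTION: constants `a = (1−δ)/4`, `E₁' = max E₁ 1`,
  `A = 8KE₁'/b + 2E₁'`, `C_r = max C 0` (`lil_rung_mono`), `c = |C_rig|`, `C_c' = max C_conv 0`,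
  `D = C_r + 4c + K(C_c' + 8C_r/b)/A`; thresholds: the SEED / RIGIDITY / CONVEXITY sides, the `L^{−ε} → 0`
  side (`tendsto_rpow_neg_atTop`: `L^{−ε} ≤ b/(4(D+1))`), and `⌈T⌉₊` for the polynomial conditions; then
  `lil_seed_floor` + `lil_ladder_fixedL` at every large even `L`, specialised to `L = 2k + 2`;
* `stub_ladderInduction` — the registered signature, `:= stub_ladderInductionOfChains stub_ladderInductionChains`;
* `stub_ladderPropagation` — the planner's LADDER (RUNG ∧ SEED ∧ RIGIDITY ∧ CONVEXITY ⇒ uniform floor), `:= stub_ladderInduction stub_lowManifoldTransfer`.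

Sources: T. Koma, H. Tasaki, J. Stat. Phys. 76 (1994) 745, §2 (tower of states). All statements folklore;
no definition and no named fact is introduced.
-/

noncomputable section

namespace Summit.HubbardSuperconductivity.HubbardSuperconductivity.Theorems

-- summit = problem name (single-conjunct summit), D-0017
set_option linter.dupNamespace false

open Literature.MathematicalPhysics.QuantumLattice Literature.Probability.LatticeModels
open Filter Set Matrix
open scoped ComplexOrder ComplexConjugate

/-! ## §4 Arithmetic of the constants -/

/-- **Budget arithmetic.** With `8KE₁' ≤ bA`, `16c ≤ bL`, `D·X ≤ (b/4)L` for
`D = C_r + 4c + K(C_c' + 8C_r/b)/A`, `0 ≤ 2J' ≤ X` and `L ≥ 1`, the seed floor minus `J'` rung losses stays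
above `bL⁴/2`. [folklore] -/
theorem lil_budget_arith {b K A E₁' Cr c Cc' L X J' : ℝ} (hb : 0 < b) (hK : 0 ≤ K) (hA : 0 < A)
    (hE : 8 * K * E₁' ≤ b * A) (hCr : 0 ≤ Cr) (hc : 0 ≤ c) (hCc : 0 ≤ Cc') (hL : 1 ≤ L)
    (hcL : 16 * c ≤ b * L)
    (hX : (Cr + 4 * c + K * (Cc' + 8 * Cr / b) / A) * X ≤ b / 4 * L)
    (hJ : 0 ≤ J') (hJX : 2 * J' ≤ X) :
    b / 2 * L ^ 4 ≤
      (b * L ^ 4 - 4 * (c / L) * L ^ 4 - K * ((E₁' / L) / (A / L)) * L ^ 4) -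
        J' * (Cr * L ^ 2 + 4 * (c / L) * L ^ 4 +
          K * ((Cc' / L ^ 2 + 4 * Cr * L ^ 2 / (b / 2 * L ^ 4)) / (A / L)) * L ^ 4) := by
  have hL0 : 0 < L := one_pos.trans_le hL
  have hL' : L ≠ 0 := hL0.ne'
  set D := Cr + 4 * c + K * (Cc' + 8 * Cr / b) / A with hD
  have hD0 : 0 ≤ D := by positivity
  -- normal forms of the three `L`-dependent quotients
  have e1 : 4 * (c / L) * L ^ 4 = 4 * c * L ^ 3 := by
    field_simp
  have e2 : K * ((E₁' / L) / (A / L)) * L ^ 4 = K * E₁' / A * L ^ 4 := by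
    field_simp
  have e3 : K * ((Cc' / L ^ 2 + 4 * Cr * L ^ 2 / (b / 2 * L ^ 4)) / (A / L)) * L ^ 4 =
      K * (Cc' + 8 * Cr / b) / A * L ^ 3 := by
    field_simp
    ring
  rw [e1, e2, e3]
  -- the seed loss `K E₁'/A · L⁴ ≤ (b/8) L⁴`
  have hseed : K * E₁' / A * L ^ 4 ≤ b / 8 * L ^ 4 := by
    have : K * E₁' / A ≤ b / 8 := by
      rw [div_le_iff₀ hA]; linarith only [hE]
    exact mul_le_mul_of_nonneg_right this (by positivity)
  -- `4cL³ ≤ (b/4)L⁴`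
  have hc4 : 4 * c * L ^ 3 ≤ b / 4 * L ^ 4 := by
    have : 4 * c ≤ b / 4 * L := by linarith only [hcL]
    nlinarith only [this, pow_nonneg hL0.le 3]
  -- the rung loss `ℓ ≤ D L³`
  have hℓ : Cr * L ^ 2 + 4 * c * L ^ 3 + K * (Cc' + 8 * Cr / b) / A * L ^ 3 ≤ D * L ^ 3 := by
    have h2 : Cr * L ^ 2 ≤ Cr * L ^ 3 := by
      have : L ^ 2 ≤ L ^ 3 := pow_le_pow_right₀ hL (by norm_num)
      exact mul_le_mul_of_nonneg_left this hCr
    have : D * L ^ 3 = Cr * L ^ 3 + 4 * c * L ^ 3 + K * (Cc' + 8 * Cr / b) / A * L ^ 3 := by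
      rw [hD]; ring
    linarith only [h2, this]
  have hℓ0 : 0 ≤ Cr * L ^ 2 + 4 * c * L ^ 3 + K * (Cc' + 8 * Cr / b) / A * L ^ 3 := by positivity
  -- `J' ℓ ≤ (X/2) D L³ ≤ (b/8) L⁴`
  have hJℓ : J' * (Cr * L ^ 2 + 4 * c * L ^ 3 + K * (Cc' + 8 * Cr / b) / A * L ^ 3) ≤ b / 8 * L ^ 4 := by
    have h1 : J' * (Cr * L ^ 2 + 4 * c * L ^ 3 + K * (Cc' + 8 * Cr / b) / A * L ^ 3) ≤ J' * (D * L ^ 3) :=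
      mul_le_mul_of_nonneg_left hℓ hJ
    have h2 : J' * (D * L ^ 3) ≤ X / 2 * (D * L ^ 3) :=
      mul_le_mul_of_nonneg_right (by linarith only [hJX]) (by positivity)
    have h3 : X / 2 * (D * L ^ 3) = D * X * L ^ 3 / 2 := by ring
    have h4 : D * X * L ^ 3 ≤ b / 4 * L * L ^ 3 := mul_le_mul_of_nonneg_right hX (by positivity)
    nlinarith only [h1, h2, h3, h4, pow_nonneg hL0.le 3]
  nlinarith only [hseed, hc4, hJℓ, pow_nonneg hL0.le 4]

/-- **Window arithmetic.** If `L ≥ 10/(1−δ)`, `L ≥ 4`, `δ ∈ (0,1)`, `(1−δ)L² − 2 < N ≤ (1−δ)L²` and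
`|ν − N| ≤ L` then `(1−δ)/4 · L² ≤ ν − 2`, `ν + 2 ≤ (2 − (1−δ)/4)L²`, `ν + 2 ≤ 2L²` and `2 < ν`. [folklore] -/
theorem lil_window_arith {δ L N ν : ℝ} (hδ0 : 0 < δ) (hδ1 : δ < 1) (hL10 : 10 / (1 - δ) ≤ L) (hL4 : 4 ≤ L)
    (hN1 : (1 - δ) * L ^ 2 - 2 < N) (hN2 : N ≤ (1 - δ) * L ^ 2) (hν : |ν - N| ≤ L) :
    (1 - δ) / 4 * L ^ 2 ≤ ν - 2 ∧ ν + 2 ≤ (2 - (1 - δ) / 4) * L ^ 2 ∧ ν + 2 ≤ 2 * L ^ 2 ∧ 2 < ν := by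
  have h1δ : 0 < 1 - δ := by linarith only [hδ1]
  have hL0 : 0 < L := by linarith only [hL4]
  have hνlo : N - L ≤ ν := by have := (abs_le.1 hν).1; linarith only [this]
  have hνhi : ν ≤ N + L := by have := (abs_le.1 hν).2; linarith only [this]
  -- `(1−δ) L ≥ 10`, hence `(3/4)(1−δ)L² ≥ (15/2) L ≥ L + 4 + …`
  have hkey : 10 ≤ (1 - δ) * L := by
    rw [div_le_iff₀ h1δ] at hL10; linarith only [hL10]
  have hkey2 : 10 * L ≤ (1 - δ) * L ^ 2 := by nlinarith only [hkey, hL0]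
  have hsq : 4 * L ≤ L ^ 2 := by nlinarith only [hL4, hL0]
  have hδL : 0 ≤ δ * L ^ 2 := by positivity
  refine ⟨?_, ?_, ?_, ?_⟩
  · nlinarith only [hνlo, hN1, hkey2, hL4]
  · nlinarith only [hνhi, hN2, hsq, hδL, hL4]
  · nlinarith only [hνhi, hN2, hsq, hδL, hL4]
  · nlinarith only [hνlo, hN1, hkey2, hL4]

/-! ## §5 The INDUCTION stub -/

/-- **(INDUCTION-OF-CHAINS)** — CHAINS ⇒ (TRANSFER ⇒ the planner's registered LADDER signature): RUNG ∧ SEED ∧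
RIGIDITY ∧ CONVEXITY ⇒ a uniform pair floor `(b/2)L⁴` for every normalised `(N_L, S^z = 0)`-sector ground
state, eventually along `L = 2k + 2`. Constants: RUNG at `a = (1−δ)/4` (constant made `≥ 0` by `lil_rung_mono`);
seed step by one TRANSFER at `m₀` with `θ₀ = E₁'/L`, `E₁' = max E₁ 1`, `τ = A/L`, `A = 8KE₁'/b + 2E₁'`; rungs
with `ρ = |C_rig|/L`, `s = C_conv⁺/L²`, `θ = s + 4C_rL²/F_min`, `F_min = bL⁴/2`; the budget holds for large
`L` because the number of rungs is `≤ L^{1−ε}/2` and `L^{−ε} → 0` (`tendsto_rpow_neg_atTop`).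
Koma–Tasaki (1994) §2 (tower of states). [folklore] -/
theorem stub_ladderInductionOfChains :
    (∀ (G : ℕ → ℝ → Prop) (N m₀ : ℕ) (W F₀ ℓ Fmin : ℝ), Even N → Even m₀ → |(m₀ : ℝ) - (N : ℝ)| ≤ W → 2 ≤ m₀ → (∀ (m : ℕ) (F F' : ℝ), F' ≤ F → G m F → G m F') → G m₀ F₀ → (∀ (n : ℕ) (F : ℝ), Even n → N ≤ n → n + 2 ≤ m₀ → Fmin ≤ F → G (n + 2) F → G n (F - ℓ)) → (∀ (n : ℕ) (F : ℝ), Even n → m₀ ≤ n + 2 → n + 4 ≤ N → Fmin ≤ F → G (n + 2) F → G (n + 4) (F - ℓ)) → 0 ≤ ℓ → (∀ J' : ℝ, 0 ≤ J' → 2 * J' ≤ W → Fmin ≤ F₀ - J' * ℓ) → G N Fmin) →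
    (∃ K : ℝ, 0 ≤ K ∧ ∀ (U : ℝ) (L : ℕ) [NeZero L] (n : ℕ) (τ ρ θ B lam : ℝ), 0 < τ → 0 ≤ ρ → 0 ≤ θ → 2 * θ ≤ τ → (∀ v ∈ Submodule.span ℂ {φ : Fock (Orb (FermionTorus 2 L)) | φ ∈ szSector n 0 ∧ ∃ E : ℝ, hubbardTorus 2 L 1 U *ᵥ φ = (E : ℂ) • φ ∧ E ≤ (hubbardTorus 2 L 1 U).minEnergyOn (szSector n 0) + τ}, (star (((pairField dWaveFormFactor L)ᴴ * pairField dWaveFormFactor L) *ᵥ v - ((lam * (L : ℝ) ^ 4 : ℝ) : ℂ) • v) ⬝ᵥ (((pairField dWaveFormFactor L)ᴴ * pairField dWaveFormFactor L) *ᵥ v - ((lam * (L : ℝ) ^ 4 : ℝ) : ℂ) • v)).re ≤ ρ ^ 2 * (L : ℝ) ^ 8 * (star v ⬝ᵥ v).re) → ∀ φ : Fock (Orb (FermionTorus 2 L)), φ ∈ szSector n 0 → star φ ⬝ᵥ φ = 1 → (expect (hubbardTorus 2 L 1 U) φ).re ≤ (hubbardTorus 2 L 1 U).minEnergyOn (szSector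 n 0) + θ → B ≤ (expect ((pairField dWaveFormFactor L)ᴴ * pairField dWaveFormFactor L) φ).re → ∀ u ∈ Submodule.span ℂ {φ : Fock (Orb (FermionTorus 2 L)) | φ ∈ szSector n 0 ∧ ∃ E : ℝ, hubbardTorus 2 L 1 U *ᵥ φ = (E : ℂ) • φ ∧ E ≤ (hubbardTorus 2 L 1 U).minEnergyOn (szSector n 0) + τ}, star u ⬝ᵥ u = 1 → B - 4 * ρ * (L : ℝ) ^ 4 - K * (θ / τ) * (L : ℝ) ^ 4 ≤ (expect ((pairField dWaveFormFactor L)ᴴ * pairField dWaveFormFactor L) u).re) → ∀ (U δ : ℝ), δ ∈ Set.Ioo (0:ℝ) 1 → (∀ (U a : ℝ), 0 < a → ∃ C : ℝ, ∀ (L : ℕ) [NeZero L] (m : ℕ) (ψ : Fock (Orb (FermionTorus 2 L))), a * (L : ℝ) ^ 2 ≤ (m : ℝ) → (m : ℝ) + 4 ≤ (2 - a) * (L : ℝ) ^ 2 → IsGroundStateInSector (hubbardTorus 2 L 1 U) (m + 2) 0 ψ → star ψ ⬝ᵥ ψ = 1 → pairField dWaveFormFactor L *ᵥ ψ ∈ szSector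 m 0 ∧ (pairField dWaveFormFactor L)ᴴ *ᵥ ψ ∈ szSector (m + 4) 0 ∧ (expect (hubbardTorus 2 L 1 U) (pairField dWaveFormFactor L *ᵥ ψ)).re - (hubbardTorus 2 L 1 U).minEnergyOn (szSector m 0) * (expect ((pairField dWaveFormFactor L)ᴴ * pairField dWaveFormFactor L) ψ).re + ((expect (hubbardTorus 2 L 1 U) ((pairField dWaveFormFactor L)ᴴ *ᵥ ψ)).re - (hubbardTorus 2 L 1 U).minEnergyOn (szSector (m + 4) 0) * (expect (pairField dWaveFormFactor L * (pairField dWaveFormFactor L)ᴴ) ψ).re) ≤ C * (L : ℝ) ^ 2 + max 0 (2 * (hubbardTorus 2 L 1 U).minEnergyOn (szSector (m + 2) 0) - (hubbardTorus 2 L 1 U).minEnergyOn (szSector m 0) - (hubbardTorus 2 L 1 U).minEnergyOn (szSector (m + 4) 0)) * (expect ((pairField dWaveFormFactor L)ᴴ * pairField dWaveFormFactor L) ψ).re ∧ (expect ((pairField dWaveFormFactor L)ᴴ * pairField dWaveFormFactor L) ψ).re ^ 2 - C * (L : ℝ) ^ 2 * (expect ((pairField dWaveFormFactor L)ᴴ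 * pairField dWaveFormFactor L) ψ).re ≤ (expect ((pairField dWaveFormFactor L)ᴴ * pairField dWaveFormFactor L) (pairField dWaveFormFactor L *ᵥ ψ)).re ∧ (expect (pairField dWaveFormFactor L * (pairField dWaveFormFactor L)ᴴ) ψ).re ^ 2 ≤ (expect ((pairField dWaveFormFactor L)ᴴ * pairField dWaveFormFactor L) ((pairField dWaveFormFactor L)ᴴ *ᵥ ψ)).re ∧ |(expect (pairField dWaveFormFactor L * (pairField dWaveFormFactor L)ᴴ) ψ).re - (expect ((pairField dWaveFormFactor L)ᴴ * pairField dWaveFormFactor L) ψ).re| ≤ C * (L : ℝ) ^ 2) → (∃ b ε E₁ : ℝ, 0 < b ∧ ε ∈ Set.Ioo (0:ℝ) 1 ∧ ∃ L₀ : ℕ, ∀ (L : ℕ) [NeZero L], L₀ ≤ L → Even L → ∃ (m : ℕ) (φ : Fock (Orb (FermionTorus 2 L))), Even m ∧ |(m : ℝ) - ((2 * ⌊(1 - δ) * (L : ℝ) ^ 2 / 2⌋₊ : ℕ) : ℝ)| ≤ (L : ℝ) ^ (1 - ε) ∧ φ ∈ szSector m 0 ∧ star φ ⬝ᵥ φ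 = 1 ∧ (expect (hubbardTorus 2 L 1 U) φ).re ≤ (hubbardTorus 2 L 1 U).minEnergyOn (szSector m 0) + E₁ / (L : ℝ) ∧ b * (L : ℝ) ^ 4 ≤ (expect ((pairField dWaveFormFactor L)ᴴ * pairField dWaveFormFactor L) φ).re) → (∀ ε ∈ Set.Ioo (0:ℝ) 1, ∀ A : ℝ, 0 < A → ∃ (C : ℝ) (L₀ : ℕ), ∀ (L : ℕ) [NeZero L], L₀ ≤ L → Even L → ∀ m : ℕ, |(m : ℝ) - ((2 * ⌊(1 - δ) * (L : ℝ) ^ 2 / 2⌋₊ : ℕ) : ℝ)| ≤ (L : ℝ) ^ (1 - ε) → ∃ lam : ℝ, ∀ v ∈ Submodule.span ℂ {φ : Fock (Orb (FermionTorus 2 L)) | φ ∈ szSector m 0 ∧ ∃ E : ℝ, hubbardTorus 2 L 1 U *ᵥ φ = (E : ℂ) • φ ∧ E ≤ (hubbardTorus 2 L 1 U).minEnergyOn (szSector m 0) + A / (L : ℝ)}, (star (((pairField dWaveFormFactor L)ᴴ * pairField dWaveFormFactor L) *ᵥ v - ((lam * (L : ℝ) ^ 4 : ℝ) : ℂ)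 • v) ⬝ᵥ (((pairField dWaveFormFactor L)ᴴ * pairField dWaveFormFactor L) *ᵥ v - ((lam * (L : ℝ) ^ 4 : ℝ) : ℂ) • v)).re ≤ (C / (L : ℝ)) ^ 2 * (L : ℝ) ^ 8 * (star v ⬝ᵥ v).re) → (∀ ε ∈ Set.Ioo (0:ℝ) 1, ∃ (C : ℝ) (L₀ : ℕ), ∀ (L : ℕ) [NeZero L], L₀ ≤ L → Even L → ∀ m : ℕ, |((m + 2 : ℕ) : ℝ) - ((2 * ⌊(1 - δ) * (L : ℝ) ^ 2 / 2⌋₊ : ℕ) : ℝ)| ≤ (L : ℝ) ^ (1 - ε) → 2 * (hubbardTorus 2 L 1 U).minEnergyOn (szSector (m + 2) 0) - (hubbardTorus 2 L 1 U).minEnergyOn (szSector m 0) - (hubbardTorus 2 L 1 U).minEnergyOn (szSector (m + 4) 0) ≤ C / (L : ℝ) ^ 2) → ∃ a : ℝ, 0 < a ∧ ∀ᶠ k : ℕ in Filter.atTop, ∀ ψ : Fock (Orb (FermionTorus 2 (2 * k + 1 + 1))), IsGroundStateInSector (hubbardTorus 2 (2 * k + 1 + 1) 1 U) (2 * ⌊(1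 - δ) * ((2 * k + 1 + 1 : ℕ) : ℝ) ^ 2 / 2⌋₊) 0 ψ → star ψ ⬝ᵥ ψ = 1 → a * ((2 * k + 1 + 1 : ℕ) : ℝ) ^ 4 ≤ (expect ((pairField dWaveFormFactor (2 * k + 1 + 1))ᴴ * pairField dWaveFormFactor (2 * k + 1 + 1)) ψ).re := by
  intro hCh hTK U δ hδ hRUNG hSEED hRIG hCONV
  obtain ⟨K, hK, hT⟩ := hTK
  obtain ⟨b, ε, E₁, hb, hε, L₀, hseed⟩ := hSEED
  have hδ0 : 0 < δ := hδ.1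
  have hδ1 : δ < 1 := hδ.2
  have h1δ : 0 < 1 - δ := by linarith only [hδ1]
  -- the constants of the ladder
  set E₁' : ℝ := max E₁ 1 with hE₁'
  have hE₁'0 : 0 < E₁' := lt_max_of_lt_right one_pos
  have hE₁E : E₁ ≤ E₁' := le_max_left _ _
  set A : ℝ := 8 * K * E₁' / b + 2 * E₁' with hAdef
  have hKE : 0 ≤ 8 * K * E₁' / b := by positivity
  have hA0 : 0 < A := by positivity
  have hA2 : 2 * E₁' ≤ A := by linarith only [hKE]
  have hA8 : 8 * K * E₁' ≤ b * A := by
    have : b * A = 8 * K * E₁' + 2 * E₁' * b := by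
      rw [hAdef]; field_simp
    nlinarith only [this, hE₁'0, hb]
  obtain ⟨Cρ, L₁, hrig⟩ := hRIG ε hε A hA0
  obtain ⟨Cc, L₂, hconv⟩ := hCONV ε hε
  set a : ℝ := (1 - δ) / 4 with hadef
  have ha : 0 < a := by positivity
  obtain ⟨C0, hrung0⟩ := hRUNG U a ha
  set Cr : ℝ := max C0 0 with hCrdef
  have hCr0 : 0 ≤ Cr := le_max_right _ _
  have hC0Cr : C0 ≤ Cr := le_max_left _ _
  set Cc' : ℝ := max Cc 0 with hCc'def
  have hCc'0 : 0 ≤ Cc' := le_max_right _ _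
  have hCcCc' : Cc ≤ Cc' := le_max_left _ _
  set c : ℝ := |Cρ| with hcdef
  have hc0 : 0 ≤ c := abs_nonneg _
  set D : ℝ := Cr + 4 * c + K * (Cc' + 8 * Cr / b) / A with hDdef
  have hD0 : 0 ≤ D := by positivity
  have hq0 : 0 < b / (4 * (D + 1)) := by positivity
  -- the `L^{-ε} → 0` threshold
  have hev : ∀ᶠ L : ℕ in atTop, ((L : ℝ)) ^ (-ε) ≤ b / (4 * (D + 1)) := by
    have ht : Tendsto (fun L : ℕ => ((L : ℝ)) ^ (-ε)) atTop (nhds 0) :=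
      (tendsto_rpow_neg_atTop hε.1).comp tendsto_natCast_atTop_atTop
    exact ht.eventually (ge_mem_nhds hq0)
  obtain ⟨L₃, hL₃⟩ := eventually_atTop.1 hev
  -- the polynomial threshold
  set T : ℝ := max (10 / (1 - δ)) (max 4 (max (Cc' + 1) (max (4 * Cr / b + 1)
    (max (2 * (Cc' + 8 * Cr / b) / A) (16 * c / b))))) with hTdef
  set Lstar : ℕ := max (max L₀ (max L₁ L₂)) (max L₃ ⌈T⌉₊) with hLstar
  -- the deterministic statement at every large even side
  have main : ∀ L : ℕ, Lstar ≤ L → ∀ [NeZero L], Even L →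
      ∀ ψ : Fock (Orb (FermionTorus 2 L)),
        IsGroundStateInSector (hubbardTorus 2 L 1 U) (2 * ⌊(1 - δ) * (L : ℝ) ^ 2 / 2⌋₊) 0 ψ →
        star ψ ⬝ᵥ ψ = 1 →
        b / 2 * (L : ℝ) ^ 4 ≤ (expect ((pairField dWaveFormFactor L)ᴴ * pairField dWaveFormFactor L) ψ).re := by
    intro L hL _ hLe
    -- unpack the thresholds
    have hmax1 : max L₀ (max L₁ L₂) ≤ L := (le_max_left _ _).trans hL
    have hmax2 : max L₃ ⌈T⌉₊ ≤ L := (le_max_right _ _).trans hL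
    have hL₀L : L₀ ≤ L := (le_max_left _ _).trans hmax1
    have hL₁L : L₁ ≤ L := ((le_max_left _ _).trans (le_max_right _ _)).trans hmax1
    have hL₂L : L₂ ≤ L := ((le_max_right _ _).trans (le_max_right _ _)).trans hmax1
    have hL₃L : L₃ ≤ L := (le_max_left _ _).trans hmax2
    have hTL : T ≤ (L : ℝ) := by
      have h1 : ⌈T⌉₊ ≤ L := (le_max_right _ _).trans hmax2
      have h2 : (⌈T⌉₊ : ℝ) ≤ L := by exact_mod_cast h1
      exact (Nat.le_ceil T).trans h2
    have h10 : 10 / (1 - δ) ≤ (L : ℝ) := (le_max_left _ _).trans hTL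
    have hT2 : max 4 (max (Cc' + 1) (max (4 * Cr / b + 1) (max (2 * (Cc' + 8 * Cr / b) / A) (16 * c / b)))) ≤ L :=
      (le_max_right _ _).trans hTL
    have h4 : (4 : ℝ) ≤ L := (le_max_left _ _).trans hT2
    have hT3 : max (Cc' + 1) (max (4 * Cr / b + 1) (max (2 * (Cc' + 8 * Cr / b) / A) (16 * c / b))) ≤ L :=
      (le_max_right _ _).trans hT2
    have hCcL : Cc' + 1 ≤ (L : ℝ) := (le_max_left _ _).trans hT3
    have hT4 : max (4 * Cr / b + 1) (max (2 * (Cc' + 8 * Cr / b) / A) (16 * c / b)) ≤ L :=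
      (le_max_right _ _).trans hT3
    have hCrL : 4 * Cr / b + 1 ≤ (L : ℝ) := (le_max_left _ _).trans hT4
    have hT5 : max (2 * (Cc' + 8 * Cr / b) / A) (16 * c / b) ≤ L := (le_max_right _ _).trans hT4
    have hθL : 2 * (Cc' + 8 * Cr / b) / A ≤ (L : ℝ) := (le_max_left _ _).trans hT5
    have hcL : 16 * c / b ≤ (L : ℝ) := (le_max_right _ _).trans hT5
    have hL1 : (1 : ℝ) ≤ L := by linarith only [h4]
    have hLpos : (0 : ℝ) < L := by linarith only [h4]
    have hεL : ((L : ℝ)) ^ (-ε) ≤ b / (4 * (D + 1)) := hL₃ L hL₃L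
    -- the particle number of the summit's sector
    set N : ℕ := 2 * ⌊(1 - δ) * (L : ℝ) ^ 2 / 2⌋₊ with hNdef
    have hNeven : Even N := ⟨⌊(1 - δ) * (L : ℝ) ^ 2 / 2⌋₊, by rw [hNdef]; ring⟩
    have hx0 : 0 ≤ (1 - δ) * (L : ℝ) ^ 2 / 2 := by positivity
    have hN2 : (N : ℝ) ≤ (1 - δ) * (L : ℝ) ^ 2 := by
      have := Nat.floor_le hx0
      rw [hNdef]; push_cast; linarith only [this]
    have hN1 : (1 - δ) * (L : ℝ) ^ 2 - 2 < N := by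
      have := Nat.lt_floor_add_one ((1 - δ) * (L : ℝ) ^ 2 / 2)
      rw [hNdef]; push_cast; linarith only [this]
    -- the seed
    obtain ⟨m₀, φ, hm₀e, hm₀W, hφS, hφ1, hφE, hφB⟩ := hseed L hL₀L hLe
    have hWL : (L : ℝ) ^ (1 - ε) ≤ L := by
      calc (L : ℝ) ^ (1 - ε) ≤ (L : ℝ) ^ (1 : ℝ) :=
            Real.rpow_le_rpow_of_exponent_le hL1 (by linarith only [hε.1])
        _ = L := Real.rpow_one _
    -- sectors of the window are within `L^{1-ε} ≤ L` of `N`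
    have hwin : ∀ ν : ℕ, min m₀ N ≤ ν → ν ≤ max m₀ N → |(ν : ℝ) - N| ≤ (L : ℝ) ^ (1 - ε) := by
      intro ν h1 h2
      have hlo : ((min m₀ N : ℕ) : ℝ) ≤ ν := by exact_mod_cast h1
      have hhi : (ν : ℝ) ≤ ((max m₀ N : ℕ) : ℝ) := by exact_mod_cast h2
      rw [Nat.cast_min] at hlo
      rw [Nat.cast_max] at hhi
      have hm := abs_le.1 hm₀W
      have hW0 : 0 ≤ (L : ℝ) ^ (1 - ε) := by positivity
      rw [abs_le]
      constructor
      · have : (N : ℝ) - (L : ℝ) ^ (1 - ε) ≤ min (m₀ : ℝ) N :=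
          le_min (by linarith only [hm.1]) (by linarith only [hW0])
        linarith only [this, hlo]
      · have : max (m₀ : ℝ) N ≤ N + (L : ℝ) ^ (1 - ε) :=
          max_le (by linarith only [hm.2]) (by linarith only [hW0])
        linarith only [this, hhi]
    have harith : ∀ ν : ℕ, min m₀ N ≤ ν → ν ≤ max m₀ N →
        (1 - δ) / 4 * (L : ℝ) ^ 2 ≤ (ν : ℝ) - 2 ∧ (ν : ℝ) + 2 ≤ (2 - (1 - δ) / 4) * (L : ℝ) ^ 2 ∧
          (ν : ℝ) + 2 ≤ 2 * (L : ℝ) ^ 2 ∧ (2 : ℝ) < ν :=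
      fun ν h1 h2 => lil_window_arith hδ0 hδ1 h10 h4 hN1 hN2 ((hwin ν h1 h2).trans hWL)
    have hm₀win := harith m₀ (min_le_left _ _) (le_max_left _ _)
    have hNwin := harith N (min_le_right _ _) (le_max_right _ _)
    have h2m₀ : 2 ≤ m₀ := by
      have := hm₀win.2.2.2
      exact_mod_cast this.le
    have hhi : max m₀ N + 2 ≤ 2 * L ^ 2 := by
      have h1 : ((m₀ + 2 : ℕ) : ℝ) ≤ ((2 * L ^ 2 : ℕ) : ℝ) := by push_cast; exact hm₀win.2.2.1
      have h2 : ((N + 2 : ℕ) : ℝ) ≤ ((2 * L ^ 2 : ℕ) : ℝ) := by push_cast; exact hNwin.2.2.1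
      have h1' : m₀ + 2 ≤ 2 * L ^ 2 := by exact_mod_cast h1
      have h2' : N + 2 ≤ 2 * L ^ 2 := by exact_mod_cast h2
      rcases le_total m₀ N with h | h
      · rw [max_eq_right h]; exact h2'
      · rw [max_eq_left h]; exact h1'
    -- rigidity on the window, in `(ρ = |C_rig|/L)`-form
    have hRig : ∀ m : ℕ, Even m → min m₀ N ≤ m → m ≤ max m₀ N → ∃ lam : ℝ,
        ∀ v ∈ Submodule.span ℂ {φ : Fock (Orb (FermionTorus 2 L)) | φ ∈ szSector m 0 ∧ ∃ E : ℝ,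
          hubbardTorus 2 L 1 U *ᵥ φ = (E : ℂ) • φ ∧ E ≤ (hubbardTorus 2 L 1 U).minEnergyOn (szSector m 0) + A / (L : ℝ)},
          (star (((pairField dWaveFormFactor L)ᴴ * pairField dWaveFormFactor L) *ᵥ v - ((lam * (L : ℝ) ^ 4 : ℝ) : ℂ) • v) ⬝ᵥ
            (((pairField dWaveFormFactor L)ᴴ * pairField dWaveFormFactor L) *ᵥ v - ((lam * (L : ℝ) ^ 4 : ℝ) : ℂ) • v)).re ≤
            (c / (L : ℝ)) ^ 2 * (L : ℝ) ^ 8 * (star v ⬝ᵥ v).re := by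
      intro m _ h1 h2
      obtain ⟨lam, hlam⟩ := hrig L hL₁L hLe m (hwin m h1 h2)
      refine ⟨lam, fun v hv => ?_⟩
      have e : (c / (L : ℝ)) ^ 2 = (Cρ / (L : ℝ)) ^ 2 := by rw [hcdef, div_pow, div_pow, sq_abs]
      rw [e]
      exact hlam v hv
    -- the start floor (seed step)
    obtain ⟨lam₀, hlam₀⟩ := hRig m₀ hm₀e (min_le_left _ _) (le_max_left _ _)
    have hθτ₀ : 2 * (E₁' / (L : ℝ)) ≤ A / (L : ℝ) := by
      rw [← mul_div_assoc]; exact div_le_div_of_nonneg_right hA2 hLpos.le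
    have hφE' : (expect (hubbardTorus 2 L 1 U) φ).re ≤
        (hubbardTorus 2 L 1 U).minEnergyOn (szSector m₀ 0) + E₁' / (L : ℝ) := by
      have : E₁ / (L : ℝ) ≤ E₁' / (L : ℝ) := div_le_div_of_nonneg_right hE₁E hLpos.le
      linarith only [hφE, this]
    have hstart := lil_seed_floor hT U L m₀ (B := b * (L : ℝ) ^ 4) (div_pos hA0 hLpos) (by positivity)
      (by positivity) hθτ₀ hlam₀ hφS hφ1 hφE' hφB
    -- numeric side conditions
    have hs1 : Cc' / (L : ℝ) ^ 2 ≤ 1 := by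
      rw [div_le_one (by positivity)]; nlinarith only [hCcL, hL1]
    have hCrF : 2 * Cr * (L : ℝ) ^ 2 ≤ b / 2 * (L : ℝ) ^ 4 := by
      have h1 : 4 * Cr ≤ b * L := by
        have := mul_le_mul_of_nonneg_left hCrL hb.le
        have e : b * (4 * Cr / b + 1) = 4 * Cr + b := by field_simp
        nlinarith only [this, e, hb]
      have h2 : b * (L : ℝ) ≤ b * (L : ℝ) ^ 2 := by
        have : (L : ℝ) ≤ (L : ℝ) ^ 2 := by nlinarith only [hL1]
        exact mul_le_mul_of_nonneg_left this hb.le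
      nlinarith only [h1, h2, pow_nonneg hLpos.le 2]
    have hθτ : 2 * (Cc' / (L : ℝ) ^ 2 + 4 * Cr * (L : ℝ) ^ 2 / (b / 2 * (L : ℝ) ^ 4)) ≤ A / (L : ℝ) := by
      have e : 2 * (Cc' / (L : ℝ) ^ 2 + 4 * Cr * (L : ℝ) ^ 2 / (b / 2 * (L : ℝ) ^ 4)) =
          2 * (Cc' + 8 * Cr / b) / (L : ℝ) ^ 2 := by
        field_simp; ring
      rw [e, div_le_div_iff₀ (by positivity) hLpos]
      have h1 : 2 * (Cc' + 8 * Cr / b) ≤ (L : ℝ) * A := (div_le_iff₀ hA0).1 hθL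
      nlinarith only [h1, hLpos, hA0]
    have hcL' : 16 * c ≤ b * (L : ℝ) := by
      have := (div_le_iff₀ hb).1 hcL; linarith only [this]
    have hX : D * (L : ℝ) ^ (1 - ε) ≤ b / 4 * (L : ℝ) := by
      have e : (L : ℝ) ^ (1 - ε) = (L : ℝ) * (L : ℝ) ^ (-ε) := by
        rw [show (1 : ℝ) - ε = 1 + -ε by ring, Real.rpow_add hLpos, Real.rpow_one]
      rw [e]
      have h1 : D * ((L : ℝ) * (L : ℝ) ^ (-ε)) ≤ D * ((L : ℝ) * (b / (4 * (D + 1)))) :=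
        mul_le_mul_of_nonneg_left (mul_le_mul_of_nonneg_left hεL hLpos.le) hD0
      have h2 : D * (b / (4 * (D + 1))) ≤ b / 4 := by
        rw [mul_div_assoc', div_le_div_iff₀ (by positivity) (by norm_num)]
        nlinarith only [hD0, hb]
      nlinarith only [h1, h2, hLpos]
    -- run the ladder
    refine lil_ladder_fixedL hK hT hCh U L N m₀ ((L : ℝ) ^ (1 - ε))
      (b * (L : ℝ) ^ 4 - 4 * (c / (L : ℝ)) * (L : ℝ) ^ 4 - K * ((E₁' / (L : ℝ)) / (A / (L : ℝ))) * (L : ℝ) ^ 4)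
      (b / 2 * (L : ℝ) ^ 4) Cr (Cc' / (L : ℝ) ^ 2) (A / (L : ℝ)) (c / (L : ℝ))
      (Cc' / (L : ℝ) ^ 2 + 4 * Cr * (L : ℝ) ^ 2 / (b / 2 * (L : ℝ) ^ 4))
      hNeven hm₀e hm₀W h2m₀ hhi hCr0 (by positivity) hs1 (by positivity) hCrF (div_pos hA0 hLpos)
      (by positivity) le_rfl hθτ ?_ ?_ hRig hstart ?_
    · -- RUNG on the window (constant made nonnegative)
      intro n hn h1 h2 ψ hψ hψ1
      have hw := harith (n + 2) h1 h2
      push_cast at hw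
      have haL : a * (L : ℝ) ^ 2 ≤ (n : ℝ) := by rw [hadef]; linarith only [hw.1]
      have hn4 : (n : ℝ) + 4 ≤ (2 - a) * (L : ℝ) ^ 2 := by rw [hadef]; linarith only [hw.2.1]
      exact lil_rung_mono hC0Cr (hrung0 L n ψ haL hn4 hψ hψ1)
    · -- convexity slack on the window
      intro n _ h1 h2
      have h := hconv L hL₂L hLe n (hwin (n + 2) h1 h2)
      exact h.trans (div_le_div_of_nonneg_right hCcCc' (by positivity))
    · -- the budget
      intro J' hJ hJW
      exact lil_budget_arith hb hK hA0 hA8 hCr0 hc0 hCc'0 hL1 hcL' hX hJ hJW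
  refine ⟨b / 2, by positivity, ?_⟩
  refine eventually_atTop.2 ⟨Lstar, fun k hk ψ hψ hψ1 => ?_⟩
  exact main (2 * k + 1 + 1) (by omega) ⟨k + 1, by ring⟩ ψ hψ hψ1


/-- **(INDUCTION) stub_ladderInduction** — the registered INDUCTION signature of line
floating-mu-two-sided-pair-transfer (TRANSFER ⇒ LADDER), from the landed CHAINS
(`stub_ladderInductionChains`, p112352) and `stub_ladderInductionOfChains`. Koma–Tasaki (1994) §2. [folklore] -/
theorem stub_ladderInduction :
    (∃ K : ℝ, 0 ≤ K ∧ ∀ (U : ℝ) (L : ℕ) [NeZero L] (n : ℕ) (τ ρ θ B lam : ℝ), 0 < τ → 0 ≤ ρ → 0 ≤ θ → 2 * θ ≤ τ → (∀ v ∈ Submodule.span ℂ {φ : Fock (Orb (FermionTorus 2 L)) | φ ∈ szSector n 0 ∧ ∃ E : ℝ, hubbardTorus 2 L 1 U *ᵥ φ = (E : ℂ) • φ ∧ E ≤ (hubbardTorus 2 L 1 U).minEnergyOn (szSector n 0) + τ}, (star (((pairField dWaveFormFactor L)ᴴ * pairField dWaveFormFactor L) *ᵥ v - ((lam * (L : ℝ)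 ^ 4 : ℝ) : ℂ) • v) ⬝ᵥ (((pairField dWaveFormFactor L)ᴴ * pairField dWaveFormFactor L) *ᵥ v - ((lam * (L : ℝ) ^ 4 : ℝ) : ℂ) • v)).re ≤ ρ ^ 2 * (L : ℝ) ^ 8 * (star v ⬝ᵥ v).re) → ∀ φ : Fock (Orb (FermionTorus 2 L)), φ ∈ szSector n 0 → star φ ⬝ᵥ φ = 1 → (expect (hubbardTorus 2 L 1 U) φ).re ≤ (hubbardTorus 2 L 1 U).minEnergyOn (szSector n 0) + θ → B ≤ (expect ((pairField dWaveFormFactor L)ᴴ * pairField dWaveFormFactor L) φ).re → ∀ u ∈ Submodule.span ℂ {φ : Fock (Orb (FermionTorus 2 L)) | φ ∈ szSector n 0 ∧ ∃ E : ℝ, hubbardTorus 2 L 1 U *ᵥ φ = (E : ℂ) • φ ∧ E ≤ (hubbardTorus 2 L 1 U).minEnergyOn (szSector n 0) + τ}, star u ⬝ᵥ u = 1 → B - 4 * ρ * (L : ℝ) ^ 4 - K * (θ / τ) * (L : ℝ) ^ 4 ≤ (expect ((pairField dWaveFormFactor L)ᴴ * pairField dWaveFormFactor L) u).re) → ∀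 (U δ : ℝ), δ ∈ Set.Ioo (0:ℝ) 1 → (∀ (U a : ℝ), 0 < a → ∃ C : ℝ, ∀ (L : ℕ) [NeZero L] (m : ℕ) (ψ : Fock (Orb (FermionTorus 2 L))), a * (L : ℝ) ^ 2 ≤ (m : ℝ) → (m : ℝ) + 4 ≤ (2 - a) * (L : ℝ) ^ 2 → IsGroundStateInSector (hubbardTorus 2 L 1 U) (m + 2) 0 ψ → star ψ ⬝ᵥ ψ = 1 → pairField dWaveFormFactor L *ᵥ ψ ∈ szSector m 0 ∧ (pairField dWaveFormFactor L)ᴴ *ᵥ ψ ∈ szSector (m + 4) 0 ∧ (expect (hubbardTorus 2 L 1 U) (pairField dWaveFormFactor L *ᵥ ψ)).re - (hubbardTorus 2 L 1 U).minEnergyOn (szSector m 0) * (expect ((pairField dWaveFormFactor L)ᴴ * pairField dWaveFormFactor L) ψ).re + ((expect (hubbardTorus 2 L 1 U) ((pairField dWaveFormFactor L)ᴴ *ᵥ ψ)).re - (hubbardTorus 2 L 1 U).minEnergyOn (szSector (m + 4) 0) * (expect (pairField dWaveFormFactor L * (pairField dWaveFormFactor L)ᴴ) ψ).re) ≤ C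 * (L : ℝ) ^ 2 + max 0 (2 * (hubbardTorus 2 L 1 U).minEnergyOn (szSector (m + 2) 0) - (hubbardTorus 2 L 1 U).minEnergyOn (szSector m 0) - (hubbardTorus 2 L 1 U).minEnergyOn (szSector (m + 4) 0)) * (expect ((pairField dWaveFormFactor L)ᴴ * pairField dWaveFormFactor L) ψ).re ∧ (expect ((pairField dWaveFormFactor L)ᴴ * pairField dWaveFormFactor L) ψ).re ^ 2 - C * (L : ℝ) ^ 2 * (expect ((pairField dWaveFormFactor L)ᴴ * pairField dWaveFormFactor L) ψ).re ≤ (expect ((pairField dWaveFormFactor L)ᴴ * pairField dWaveFormFactor L) (pairField dWaveFormFactor L *ᵥ ψ)).re ∧ (expect (pairField dWaveFormFactor L * (pairField dWaveFormFactor L)ᴴ) ψ).re ^ 2 ≤ (expect ((pairField dWaveFormFactor L)ᴴ * pairField dWaveFormFactor L) ((pairField dWaveFormFactor L)ᴴ *ᵥ ψ)).re ∧ |(expect (pairField dWaveFormFactor L * (pairField dWaveFormFactor L)ᴴ) ψ).re - (expect ((pairField dWaveFormFactor L)ᴴ * pairField dWaveFormFactor L) ψ).re| ≤ C * (L : ℝ)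 ^ 2) → (∃ b ε E₁ : ℝ, 0 < b ∧ ε ∈ Set.Ioo (0:ℝ) 1 ∧ ∃ L₀ : ℕ, ∀ (L : ℕ) [NeZero L], L₀ ≤ L → Even L → ∃ (m : ℕ) (φ : Fock (Orb (FermionTorus 2 L))), Even m ∧ |(m : ℝ) - ((2 * ⌊(1 - δ) * (L : ℝ) ^ 2 / 2⌋₊ : ℕ) : ℝ)| ≤ (L : ℝ) ^ (1 - ε) ∧ φ ∈ szSector m 0 ∧ star φ ⬝ᵥ φ = 1 ∧ (expect (hubbardTorus 2 L 1 U) φ).re ≤ (hubbardTorus 2 L 1 U).minEnergyOn (szSector m 0) + E₁ / (L : ℝ) ∧ b * (L : ℝ) ^ 4 ≤ (expect ((pairField dWaveFormFactor L)ᴴ * pairField dWaveFormFactor L) φ).re) → (∀ ε ∈ Set.Ioo (0:ℝ) 1, ∀ A : ℝ, 0 < A → ∃ (C : ℝ) (L₀ : ℕ), ∀ (L : ℕ) [NeZero L], L₀ ≤ L → Even L → ∀ m : ℕ, |(m : ℝ) - ((2 * ⌊(1 - δ) * (L : ℝ) ^ 2 / 2⌋₊ : ℕ) : ℝ)| ≤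 (L : ℝ) ^ (1 - ε) → ∃ lam : ℝ, ∀ v ∈ Submodule.span ℂ {φ : Fock (Orb (FermionTorus 2 L)) | φ ∈ szSector m 0 ∧ ∃ E : ℝ, hubbardTorus 2 L 1 U *ᵥ φ = (E : ℂ) • φ ∧ E ≤ (hubbardTorus 2 L 1 U).minEnergyOn (szSector m 0) + A / (L : ℝ)}, (star (((pairField dWaveFormFactor L)ᴴ * pairField dWaveFormFactor L) *ᵥ v - ((lam * (L : ℝ) ^ 4 : ℝ) : ℂ) • v) ⬝ᵥ (((pairField dWaveFormFactor L)ᴴ * pairField dWaveFormFactor L) *ᵥ v - ((lam * (L : ℝ) ^ 4 : ℝ) : ℂ) • v)).re ≤ (C / (L : ℝ)) ^ 2 * (L : ℝ) ^ 8 * (star v ⬝ᵥ v).re) → (∀ ε ∈ Set.Ioo (0:ℝ) 1, ∃ (C : ℝ) (L₀ : ℕ), ∀ (L : ℕ) [NeZero L], L₀ ≤ L → Even L → ∀ m : ℕ, |((m + 2 : ℕ) : ℝ) - ((2 * ⌊(1 - δ) * (L : ℝ) ^ 2 / 2⌋₊ : ℕ) : ℝ)| ≤ (L : ℝ) ^ (1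 - ε) → 2 * (hubbardTorus 2 L 1 U).minEnergyOn (szSector (m + 2) 0) - (hubbardTorus 2 L 1 U).minEnergyOn (szSector m 0) - (hubbardTorus 2 L 1 U).minEnergyOn (szSector (m + 4) 0) ≤ C / (L : ℝ) ^ 2) → ∃ a : ℝ, 0 < a ∧ ∀ᶠ k : ℕ in Filter.atTop, ∀ ψ : Fock (Orb (FermionTorus 2 (2 * k + 1 + 1))), IsGroundStateInSector (hubbardTorus 2 (2 * k + 1 + 1) 1 U) (2 * ⌊(1 - δ) * ((2 * k + 1 + 1 : ℕ) : ℝ) ^ 2 / 2⌋₊) 0 ψ → star ψ ⬝ᵥ ψ = 1 → a * ((2 * k + 1 + 1 : ℕ) : ℝ) ^ 4 ≤ (expect ((pairField dWaveFormFactor (2 * k + 1 + 1))ᴴ * pairField dWaveFormFactor (2 * k + 1 + 1)) ψ).re :=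
  stub_ladderInductionOfChains stub_ladderInductionChains

/-- **(LADDER) stub_ladderPropagation** — the planner's registered LADDER signature of line
floating-mu-two-sided-pair-transfer (RUNG ∧ SEED ∧ RIGIDITY ∧ CONVEXITY ⇒ the uniform pair floor), CLOSED: the
INDUCTION applied to the landed TRANSFER (`stub_lowManifoldTransfer`, p100011). Koma–Tasaki (1994) §2. [folklore] -/
theorem stub_ladderPropagation :
    ∀ (U δ : ℝ), δ ∈ Set.Ioo (0:ℝ) 1 → (∀ (U a : ℝ), 0 < a → ∃ C : ℝ, ∀ (L : ℕ) [NeZero L] (m : ℕ) (ψ : Fock (Orb (FermionTorus 2 L))), a * (L : ℝ) ^ 2 ≤ (m : ℝ) → (m : ℝ) + 4 ≤ (2 - a) * (L : ℝ) ^ 2 → IsGroundStateInSector (hubbardTorus 2 L 1 U) (m + 2) 0 ψ → star ψ ⬝ᵥ ψ = 1 → pairField dWaveFormFactor L *ᵥ ψ ∈ szSector m 0 ∧ (pairField dWaveFormFactor L)ᴴ *ᵥ ψ ∈ szSector (m + 4) 0 ∧ (expect (hubbardTorus 2 L 1 U) (pairField dWaveFormFactor L *ᵥ ψ)).re - (hubbardTorus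 2 L 1 U).minEnergyOn (szSector m 0) * (expect ((pairField dWaveFormFactor L)ᴴ * pairField dWaveFormFactor L) ψ).re + ((expect (hubbardTorus 2 L 1 U) ((pairField dWaveFormFactor L)ᴴ *ᵥ ψ)).re - (hubbardTorus 2 L 1 U).minEnergyOn (szSector (m + 4) 0) * (expect (pairField dWaveFormFactor L * (pairField dWaveFormFactor L)ᴴ) ψ).re) ≤ C * (L : ℝ) ^ 2 + max 0 (2 * (hubbardTorus 2 L 1 U).minEnergyOn (szSector (m + 2) 0) - (hubbardTorus 2 L 1 U).minEnergyOn (szSector m 0) - (hubbardTorus 2 L 1 U).minEnergyOn (szSector (m + 4) 0)) * (expect ((pairField dWaveFormFactor L)ᴴ * pairField dWaveFormFactor L) ψ).re ∧ (expect ((pairField dWaveFormFactor L)ᴴ * pairField dWaveFormFactor L) ψ).re ^ 2 - C * (L : ℝ) ^ 2 * (expect ((pairField dWaveFormFactor L)ᴴ * pairField dWaveFormFactor L) ψ).re ≤ (expect ((pairField dWaveFormFactor L)ᴴ * pairField dWaveFormFactor L) (pairField dWaveFormFactor L *ᵥ ψ)).re ∧ (expect (pairField dWaveFormFactor L * (pairField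 dWaveFormFactor L)ᴴ) ψ).re ^ 2 ≤ (expect ((pairField dWaveFormFactor L)ᴴ * pairField dWaveFormFactor L) ((pairField dWaveFormFactor L)ᴴ *ᵥ ψ)).re ∧ |(expect (pairField dWaveFormFactor L * (pairField dWaveFormFactor L)ᴴ) ψ).re - (expect ((pairField dWaveFormFactor L)ᴴ * pairField dWaveFormFactor L) ψ).re| ≤ C * (L : ℝ) ^ 2) → (∃ b ε E₁ : ℝ, 0 < b ∧ ε ∈ Set.Ioo (0:ℝ) 1 ∧ ∃ L₀ : ℕ, ∀ (L : ℕ) [NeZero L], L₀ ≤ L → Even L → ∃ (m : ℕ) (φ : Fock (Orb (FermionTorus 2 L))), Even m ∧ |(m : ℝ) - ((2 * ⌊(1 - δ) * (L : ℝ) ^ 2 / 2⌋₊ : ℕ) : ℝ)| ≤ (L : ℝ) ^ (1 - ε) ∧ φ ∈ szSector m 0 ∧ star φ ⬝ᵥ φ = 1 ∧ (expect (hubbardTorus 2 L 1 U) φ).re ≤ (hubbardTorus 2 L 1 U).minEnergyOn (szSector m 0) + E₁ / (L : ℝ) ∧ b * (L : ℝ) ^ 4 ≤ (expect ((pairField dWaveFormFactor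 L)ᴴ * pairField dWaveFormFactor L) φ).re) → (∀ ε ∈ Set.Ioo (0:ℝ) 1, ∀ A : ℝ, 0 < A → ∃ (C : ℝ) (L₀ : ℕ), ∀ (L : ℕ) [NeZero L], L₀ ≤ L → Even L → ∀ m : ℕ, |(m : ℝ) - ((2 * ⌊(1 - δ) * (L : ℝ) ^ 2 / 2⌋₊ : ℕ) : ℝ)| ≤ (L : ℝ) ^ (1 - ε) → ∃ lam : ℝ, ∀ v ∈ Submodule.span ℂ {φ : Fock (Orb (FermionTorus 2 L)) | φ ∈ szSector m 0 ∧ ∃ E : ℝ, hubbardTorus 2 L 1 U *ᵥ φ = (E : ℂ) • φ ∧ E ≤ (hubbardTorus 2 L 1 U).minEnergyOn (szSector m 0) + A / (L : ℝ)}, (star (((pairField dWaveFormFactor L)ᴴ * pairField dWaveFormFactor L) *ᵥ v - ((lam * (L : ℝ) ^ 4 : ℝ) : ℂ) • v) ⬝ᵥ (((pairField dWaveFormFactor L)ᴴ * pairField dWaveFormFactor L) *ᵥ v - ((lam * (L : ℝ) ^ 4 : ℝ) : ℂ) • v)).re ≤ (C / (L : ℝ)) ^ 2 * (L : ℝ)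 ^ 8 * (star v ⬝ᵥ v).re) → (∀ ε ∈ Set.Ioo (0:ℝ) 1, ∃ (C : ℝ) (L₀ : ℕ), ∀ (L : ℕ) [NeZero L], L₀ ≤ L → Even L → ∀ m : ℕ, |((m + 2 : ℕ) : ℝ) - ((2 * ⌊(1 - δ) * (L : ℝ) ^ 2 / 2⌋₊ : ℕ) : ℝ)| ≤ (L : ℝ) ^ (1 - ε) → 2 * (hubbardTorus 2 L 1 U).minEnergyOn (szSector (m + 2) 0) - (hubbardTorus 2 L 1 U).minEnergyOn (szSector m 0) - (hubbardTorus 2 L 1 U).minEnergyOn (szSector (m + 4) 0) ≤ C / (L : ℝ) ^ 2) → ∃ a : ℝ, 0 < a ∧ ∀ᶠ k : ℕ in Filter.atTop, ∀ ψ : Fock (Orb (FermionTorus 2 (2 * k + 1 + 1))), IsGroundStateInSector (hubbardTorus 2 (2 * k + 1 + 1) 1 U) (2 * ⌊(1 - δ) * ((2 * k + 1 + 1 : ℕ) : ℝ) ^ 2 / 2⌋₊) 0 ψ → star ψ ⬝ᵥ ψ = 1 → a * ((2 * k + 1 + 1 : ℕ) : ℝ) ^ 4 ≤ (expect ((pairField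 dWaveFormFactor (2 * k + 1 + 1))ᴴ * pairField dWaveFormFactor (2 * k + 1 + 1)) ψ).re :=
  stub_ladderInduction stub_lowManifoldTransfer

end Summit.HubbardSuperconductivity.HubbardSuperconductivity.Theorems

end
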